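import Mathlib
import Summits.Ventures.PercRepro2.SwOutAll
import Summits.Ventures.PercRepro2.SwOutSeriesDefs
import Summits.Ventures.PercRepro2.SwOutSeriesContract
import Summits.Ventures.PercRepro2.SwOutSeriesContractCount
import Summits.Ventures.PercRepro2.SwOutSeriesDelete
import Summits.Ventures.PercRepro2.SwOutSeriesDeleteCount
import Summits.Ventures.PercRepro2.SwOutSeriesThm
import Summits.Ventures.PercRepro2.SwOutLeaf
import Summits.Ventures.PercRepro2.SwOutLeafThm
import Summits.Ventures.PercRepro2.SwOutLoop
import Summits.Ventures.PercRepro2.SwOutLoopThm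
import Summits.Ventures.PercRepro2.SwOutReducible
import Summits.Ventures.PercRepro2.SwOutArmFlip
import Summits.Ventures.PercRepro2.SwOutArms
import Summits.Ventures.PercRepro2.SwOutArmOrbit
import Summits.Ventures.PercRepro2.SwOutArmCube
import Summits.Ventures.PercRepro2.SwOutArmThm
import Summits.Ventures.PercRepro2.SwOutJunctionSplit
import Summits.Ventures.PercRepro2.SwOutJunctionFine
import Summits.Ventures.PercRepro2.SwOutJunctionRegion
import Summits.Ventures.PercRepro2.SwOutJunction
import Summits.Ventures.PercRepro2.SwOutJunctionsSplit
import Summits.Ventures.PercRepro2.SwOutJunctionsFine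
import Summits.Ventures.PercRepro2.SwOutJunctionsRegion
import Summits.Ventures.PercRepro2.SwOutJunctions
import Summits.Ventures.PercRepro2.SwOutAdjSplit
import Summits.Ventures.PercRepro2.SwOutAdjFine
import Summits.Ventures.PercRepro2.SwOutAdjRegion
import Summits.Ventures.PercRepro2.SwOutAdjMatched
import Summits.Ventures.PercRepro2.SwOutAdjCongr
import Summits.Ventures.PercRepro2.SwOutAdjBlock
import Summits.Ventures.PercRepro2.SwOutAdjIneq
import Summits.Ventures.PercRepro2.SwOutAdjThm

/-!
# Row (SW) from the adjacent-junction theorem (blind cell PercRepro2, night-4 g11, 2026-08-25;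
proofs/NIGHT4-G11.md §5(5))

Row (SW) holds on every graph in which every vertex other than `l, h, o` is joined to `l` or
belongs to a set `J` of vertices (not joined to `l`, without loops, `h ∉ J`) all of whose
neighbours other than `h` — junction neighbours included — are joined to `h`
(**`sw_of_adjJunctions`**).  Corollary: (SW) on every CONE over `h` — `h` adjacent to every
vertex other than `l` (**`sw_of_cone`**, every `o`).  Instances: the complete graph `K_{n+4}`
minus ANY star at `l` (`sw_complete_minus_star`: `l = 0` joined exactly to the vertices of a set
`A`, `h = 1`, every `o`; the non-neighbours of `l` form a clique of junctions) and every wheel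
with the apex `l` joined to any set of rim vertices (`sw_wheel_any`).
-/

namespace Summit.Ventures.PercRepro2

namespace LocRows

open Hull

variable {V : Type*} {E : Type*} [Fintype E] [DecidableEq E]

open scoped Classical

variable {ends : E → Sym2 V} {l h o : V} {J : Set V}

/-- A region with a set of junctions (adjacent junctions allowed) is a base region of the series
reduction. -/
theorem reducible_of_adjJunctions {U : Set V} (hl : l ∉ U) (hloop_h : ∀ e, ends e ≠ s(h, h))
    (hJU : J ⊆ U) (hhJ : h ∉ J)
    (hadj : ∀ u ∈ J, ∀ e (he : u ∈ ends e), Sym2.Mem.other he ≠ h →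
      ∃ e', ends e' = s(Sym2.Mem.other he, h))
    (hout : ∀ x ∈ U, x ≠ h → x ≠ o → x ∉ J →
      (∃ e y, ends e = s(x, y) ∧ y ∉ U) ∨ (∀ e, x ∉ ends e)) :
    Reducible l h o ends U :=
  Reducible.base ends U fun ξ _ h𝓔 =>
    rigidOK_of_adjJunctions (ξ := ξ) hl hloop_h hJU hhJ hadj hout h𝓔

/-- **Row 2′SW-ALL on every graph with a set of junctions** (adjacent junctions allowed): every
vertex other than `l, h, o` is joined to `l` or lies in `J`; `l, h ∉ J`; no loop at `h`; every
neighbour of a junction other than `h` is joined to `h`. -/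
theorem swAll_of_adjJunctions (hlh : l ≠ h) (hloop_h : ∀ e, ends e ≠ s(h, h)) (hlJ : l ∉ J)
    (hhJ : h ∉ J)
    (hadj : ∀ u ∈ J, ∀ e (he : u ∈ ends e), Sym2.Mem.other he ≠ h →
      ∃ e', ends e' = s(Sym2.Mem.other he, h))
    (hjoin : ∀ x, x ≠ l → x ≠ h → x ≠ o → x ∉ J → ∃ e, ends e = s(x, l)) : SwAll ends l h o := by
  have hJU : J ⊆ ({l}ᶜ : Set V) := by
    intro u hu
    simp only [Set.mem_compl_iff, Set.mem_singleton_iff]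
    rintro rfl
    exact hlJ hu
  refine swAll_of_reducible l h o hlh
    (reducible_of_adjJunctions (by simp) hloop_h hJU hhJ hadj ?_)
  intro x hx hxh hxo hxJ
  obtain ⟨e, he⟩ := hjoin x (by simpa using hx) hxh hxo hxJ
  exact Or.inl ⟨e, l, he, by simp⟩

/-- **Row (SW) on every graph with a set of junctions**, adjacent junctions allowed (see
`swAll_of_adjJunctions`). -/
theorem sw_of_adjJunctions (hlh : l ≠ h) (hloop_h : ∀ e, ends e ≠ s(h, h)) (hlJ : l ∉ J)
    (hhJ : h ∉ J)
    (hadj : ∀ u ∈ J, ∀ e (he : u ∈ ends e), Sym2.Mem.other he ≠ h →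
      ∃ e', ends e' = s(Sym2.Mem.other he, h))
    (hjoin : ∀ x, x ≠ l → x ≠ h → x ≠ o → x ∉ J → ∃ e, ends e = s(x, l)) : Sw ends l h o :=
  sw_of_swAll ends (swAll_of_adjJunctions hlh hloop_h hlJ hhJ hadj hjoin)

/-- **Row (SW) on every cone over `h`**: if `h` carries no loop and is adjacent to every vertex
other than `l` (and itself), then (SW) holds for every `o` — the non-neighbours of `l` form a
set of junctions (adjacent junctions allowed) whose neighbours other than `h` are all joined to
`h`. -/
theorem sw_of_cone (hlh : l ≠ h) (hloop_h : ∀ e, ends e ≠ s(h, h))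
    (hcone : ∀ x, x ≠ l → x ≠ h → ∃ e, ends e = s(x, h)) : Sw ends l h o := by
  refine sw_of_adjJunctions (J := {x | x ≠ l ∧ x ≠ h ∧ ∀ e, ends e ≠ s(x, l)}) hlh hloop_h
    (fun h' => h'.1 rfl) (fun h' => h'.2.1 rfl) ?_ ?_
  · intro u hu e he hne
    refine hcone _ ?_ hne
    intro hpl
    apply hu.2.2 e
    rw [← Sym2.other_spec he, hpl]
  · intro x hxl hxh _ hxJ
    by_contra hno
    exact hxJ ⟨hxl, hxh, fun e he => hno ⟨e, he⟩⟩

/-! ## The infinite family: the complete graph minus any star at `l` -/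

/-- The complete graph `K_{n+4}` on `Fin (n + 4)` with the vertex `l = 0` joined exactly to the
vertices of `A`: the edges are the pairs `a < b` with `b ∈ A` whenever `a = 0`. -/
def completeMinusStarEnds (n : ℕ) (A : Finset (Fin (n + 4))) :
    {p : Fin (n + 4) × Fin (n + 4) // p.1 < p.2 ∧ (p.1.val = 0 → p.2 ∈ A)} →
      Sym2 (Fin (n + 4)) :=
  fun p => s(p.1.1, p.1.2)

/-- **Row (SW) on `K_{n+4}` minus any star at `l`** (`l = 0` joined exactly to `A`, `h = 1`,
every `o`): the non-neighbours of `l` other than `h` form a clique of junctions, all adjacent to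
each other and to everything else. -/
theorem sw_complete_minus_star (n : ℕ) (A : Finset (Fin (n + 4))) (o : Fin (n + 4)) :
    Sw (completeMinusStarEnds n A) ⟨0, by omega⟩ ⟨1, by omega⟩ o := by
  set l : Fin (n + 4) := ⟨0, by omega⟩ with hl
  set h : Fin (n + 4) := ⟨1, by omega⟩ with hh
  have hlh : l ≠ h := fun h' => by have := congrArg Fin.val h'; simp [hl, hh] at this
  have hnoloop : ∀ (v : Fin (n + 4)) (e : {p : Fin (n + 4) × Fin (n + 4) //
      p.1 < p.2 ∧ (p.1.val = 0 → p.2 ∈ A)}), completeMinusStarEnds n A e ≠ s(v, v) := by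
    rintro v ⟨⟨a, b⟩, hab, _⟩ h'
    simp only [completeMinusStarEnds, Sym2.eq_iff] at h'
    rcases h' with ⟨rfl, rfl⟩ | ⟨rfl, rfl⟩ <;> exact lt_irrefl _ hab
  -- the junctions: the vertices other than `l, h` not joined to `l`
  refine sw_of_adjJunctions (J := {x | 2 ≤ x.val ∧ x ∉ A}) hlh (hnoloop h) ?_ ?_ ?_ ?_
  · simp [hl]
  · simp [hh]
  · rintro u ⟨hu2, huA⟩ ⟨⟨a, b⟩, hab, hA⟩ he hph
    simp only [completeMinusStarEnds, Sym2.mem_iff] at he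
    rw [Fin.lt_def] at hab
    dsimp only at hab
    rcases he with rfl | rfl
    · -- the edge `(u, b)` with `u < b`: the other end is `b ≠ l`, joined to `h` by `(h, b)`
      have hb2 : b ≠ u := fun h' => by rw [h'] at hab; exact lt_irrefl _ hab
      have hoth : Sym2.Mem.other he = b := other_eq_of_ends he rfl hb2
      rw [hoth]
      have h1b : h < b := by rw [Fin.lt_def]; simp only [hh]; omega
      refine ⟨⟨(h, b), h1b, fun h' => by simp [hh] at h'⟩, ?_⟩
      simp [completeMinusStarEnds, Sym2.eq_swap]
    · -- the edge `(a, u)` with `a < u`: `a ≠ l` (`u ∉ A`), so `a = h` or `a` is joined to `h`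
      have ha2 : a ≠ u := fun h' => by rw [h'] at hab; exact lt_irrefl _ hab
      have hoth : Sym2.Mem.other he = a :=
        other_eq_of_ends he (by simp [completeMinusStarEnds, Sym2.eq_swap]) ha2
      rw [hoth]
      rw [hoth] at hph
      have ha0 : a.val ≠ 0 := fun h0 => huA (hA h0)
      have ha1 : a.val ≠ 1 := fun h1 => hph (Fin.ext (by simp only [hh]; omega))
      have h1a : h < a := by rw [Fin.lt_def]; simp only [hh]; omega
      refine ⟨⟨(h, a), h1a, fun h' => by simp [hh] at h'⟩, ?_⟩
      simp [completeMinusStarEnds, Sym2.eq_swap]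
  · intro x hx0 hx1 _ hxJ
    have hx0' : x.val ≠ 0 := fun h' => hx0 (Fin.ext h')
    have hx1' : x.val ≠ 1 := fun h' => hx1 (Fin.ext h')
    have hxA : x ∈ A := by
      by_contra hxA
      exact hxJ ⟨by omega, hxA⟩
    have h0x : l < x := by rw [Fin.lt_def]; simp only [hl]; omega
    refine ⟨⟨(l, x), h0x, fun _ => hxA⟩, ?_⟩
    simp [completeMinusStarEnds, Sym2.eq_swap]

/-! ## The infinite family: the wheel with the apex joined to any set of rim vertices -/

/-- The wheel with hub `h = inl 1`, rim `Fin (k + 3)` (cyclic) and the apex `l = inl 0` joined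
exactly to the rim vertices of `A`: the edges are the rim edges `inl i = (i, i + 1)`, the spokes
`inr (inl i) = (h, i)` and the apex edges `inr (inr i) = (l, i)` for `i ∈ A`. -/
def wheelAnyEnds (k : ℕ) (A : Finset (Fin (k + 3))) :
    Fin (k + 3) ⊕ Fin (k + 3) ⊕ {i : Fin (k + 3) // i ∈ A} → Sym2 (Fin 2 ⊕ Fin (k + 3))
  | Sum.inl i => s(Sum.inr i, Sum.inr (i + 1))
  | Sum.inr (Sum.inl i) => s(Sum.inl 1, Sum.inr i)
  | Sum.inr (Sum.inr i) => s(Sum.inl 0, Sum.inr i.1)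

/-- The cyclic successor of a rim vertex differs from it. -/
lemma wheel_succ_ne (k : ℕ) (i : Fin (k + 3)) : i + 1 ≠ i := by
  intro h'
  have h1 : (1 : Fin (k + 3)) = 0 := add_eq_left.1 h'
  rw [Fin.one_eq_zero_iff] at h1
  omega

/-- **Row (SW) on every wheel with the apex joined to any set of rim vertices** (`l = inl 0`,
`h = inl 1` the hub, every `o`): the rim vertices not joined to the apex are junctions (their
neighbours are the hub and two rim vertices, all joined to the hub); adjacent junctions occur
whenever two consecutive rim vertices miss the apex. -/
theorem sw_wheel_any (k : ℕ) (A : Finset (Fin (k + 3))) (o : Fin 2 ⊕ Fin (k + 3)) :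
    Sw (wheelAnyEnds k A) (Sum.inl 0) (Sum.inl 1) o := by
  have hloop_h : ∀ e, wheelAnyEnds k A e ≠ s(Sum.inl 1, Sum.inl 1) := by
    rintro (j | j | ⟨j, hj⟩) h' <;> simp [wheelAnyEnds] at h'
  refine sw_of_adjJunctions (J := {x | ∃ i, i ∉ A ∧ x = Sum.inr i}) (by simp) hloop_h ?_ ?_ ?_ ?_
  · rintro ⟨i, _, h'⟩; exact absurd h' (by simp)
  · rintro ⟨i, _, h'⟩; exact absurd h' (by simp)
  · rintro u ⟨i, hiA, rfl⟩ (j | j | ⟨j, hj⟩) he hph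
    · -- a rim edge `(j, j + 1)` at `i`: the other end is a rim vertex, joined to the hub by its spoke
      have hmem : Sum.inr i ∈ wheelAnyEnds k A (Sum.inl j) := he
      simp only [wheelAnyEnds, Sym2.mem_iff, Sum.inr.injEq] at hmem
      rcases hmem with rfl | rfl
      · have hoth : Sym2.Mem.other he = Sum.inr (i + 1) :=
          other_eq_of_ends he rfl (fun h' => wheel_succ_ne k i (Sum.inr.inj h'))
        rw [hoth]
        exact ⟨Sum.inr (Sum.inl (i + 1)), by simp [wheelAnyEnds, Sym2.eq_swap]⟩
      · have hoth : Sym2.Mem.other he = Sum.inr j :=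
          other_eq_of_ends he (by simp [wheelAnyEnds, Sym2.eq_swap])
            (fun h' => wheel_succ_ne k j (Sum.inr.inj h').symm)
        rw [hoth]
        exact ⟨Sum.inr (Sum.inl j), by simp [wheelAnyEnds, Sym2.eq_swap]⟩
    · -- a spoke at `i`: the other end is the hub, excluded
      exfalso
      have hmem : Sum.inr i ∈ wheelAnyEnds k A (Sum.inr (Sum.inl j)) := he
      simp only [wheelAnyEnds, Sym2.mem_iff, Sum.inr.injEq, reduceCtorEq, false_or] at hmem
      subst hmem
      have hoth : Sym2.Mem.other he = Sum.inl 1 :=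
        other_eq_of_ends he (by simp [wheelAnyEnds, Sym2.eq_swap]) (by simp)
      exact hph hoth
    · -- an apex edge at `i`: impossible, `i ∉ A`
      exfalso
      have hmem : Sum.inr i ∈ wheelAnyEnds k A (Sum.inr (Sum.inr ⟨j, hj⟩)) := he
      simp only [wheelAnyEnds, Sym2.mem_iff, Sum.inr.injEq, reduceCtorEq, false_or] at hmem
      subst hmem
      exact hiA hj
  · rintro (a | i) hx0 hx1 _ hxJ
    · exfalso
      fin_cases a
      · exact hx0 rfl
      · exact hx1 rfl
    · have hiA : i ∈ A := by
        by_contra hiA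
        exact hxJ ⟨i, hiA, rfl⟩
      exact ⟨Sum.inr (Sum.inr ⟨i, hiA⟩), by simp [wheelAnyEnds, Sym2.eq_swap]⟩

end LocRows

end Summit.Ventures.PercRepro2
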